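/-
Copyright (c) 2026 the pub-hodgecm-mathlib formalisation cell (harness21).  Prover seat hodgecm-mathlib-F0P3a-p01 (g31), req620 Track A «(D-RAM) FOUR-FRAME» squad
(MS ROAD A, STAGE B brick B3₂ «TYPE-2 STRATA TABLE» — the residual-family kills X3, X4, X6, X7 of LH4-p04 (g2)'s sieve ★ `typeTwo_sieve`; dealt «by disjunct number»
2026-09-04T00:23:58Z).  2026-09-04.
-/
import Summits.HodgeConjecture.HodgeConjecture.Theorems.F0P3cDyRamDiagonalHNFDualFrameValuesTypeTwo   -- ★ p856101 PART 5 (LH4-p04): `dualFrame_sandwich`, `gram_values_of_type`; brings ★ HNF `normalised_latt_hnf_iff`, ★ TorusDefs `IsNormalisedLattice`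
import HarnessLib

/-!
# Crux `H413`, line LH4 «(D-RAM) FOUR-FRAME» road — unit U3_Laws (iii), MS ROAD A, STAGE B brick B3₂: THE ONE-ENTRY KILLS X3, X4, X6, X7
# (four residual families of the type-2 integer sieve die on the Gram entry `G₀₁ = σx·D₁·ϖ^b + σy·D₂·z` alone: its two terms have DISTINCT valuations and the larger exceeds `1`)

Cell `hodgecm-mathlib` (D-0151), FLOOR 0, crux item H413 = `stmt-HodgeConjecture-24833`, route of record `HCCMUnconditional`; squad F0∕P3c∕LH4 (req618∕req620).  THEOREMS ONLY
(no `def`, no instance, no notation, no `sorry`, default heartbeats); lane `--supports stmt-HodgeConjecture-24833 --as helper` (count-neutral).  Consumer: LH4-p04 (g2)'s B3₂-γ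
«shapes₂» = ★ PART 6b `typeTwo_sieve` ∘ (X-kills) ∘ axis lemmas (CENSUS `F0/P3c/LH4/LH4-p04/g2/CENSUS-B3type2.v1.LH4p04g2.md` a4471ff38a9ce6de §1–§2).

SETTING.  `N = latt V`, `V = (1 0 0; x ϖ^b 0; y z ϖ^c)`, `x y z ∈ 𝒪`, `N` NORMALISED, and TYPE-2 POLARISABLE: `∃ D` `σ`-fixed non-degenerate diagonal with `IsVertexLattice σ ϖ (diag D) 2 N`;
`σ` valuation-preserving, `|ϖ| = exp(−1)`, and the datum's parity clause `hfix` (`σ`-fixed non-zero elements have EVEN valuation).  Binders = ★ `typeTwo_sieve`'s, plus the residual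
family's own clauses as hypotheses; conclusion `False`.
WHAT IS PROVED.
* §1 ENGINE `gram01_exponents`: under `v z = v(ϖ^k)`, `|y| = 1`, `b ≥ 1`, there are `n₁ n₂ : ℤ` with `|D₁| = exp 2n₁`, `|D₂| = exp 2n₂` satisfying the integer SANDWICH of ★ PART 5
  (slot 1: `b − 1 ≤ 2n₁`, `b + c − k − 1 ≤ 2n₁`, `2n₁ ≤ b ∨ 2n₁ ≤ b + c − k`; slot 2: `c − 1 ≤ 2n₂ ≤ c`) and the `G₀₁` ALTERNATIVE from ★ `gram_values_of_type` (entry `(0,1)` integral):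
  EITHER the two terms of `G₀₁` have equal valuation (`2n₁ − b = 2n₂ − k`) OR both are integral (`2n₁ − b ≤ 0 ∧ 2n₂ − k ≤ 0`) — ultrametric equality `|A + B| = max(|A|,|B|)` for `|A| ≠ |B|`
  (`Valuation.map_add_of_distinct_val`); `|x| = 1` from normalisation at `b ≥ 1` (★ `normalised_latt_hnf_iff`).
* §2 THE KILLS, each `… → False` by `omega` on §1's integers: `typeTwo_exclX3` (`1 ≤ b`, `c` odd, `2b < c`, `v z = v ϖ^{c−b}`, `|y| = 1`: `2n₁ = 2b`, `2n₂ = c − 1`, terms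
  `exp b ≠ exp(b−1)`, so `exp b ≤ 1` — absurd); `typeTwo_exclX4` (`2 ≤ b`, `c` even, `2b ≤ c`, `v z = v ϖ^{c−b+1}`: `2n₁ = 2b − 2`, `2n₂ = c`, terms `exp(b−2) ≠ exp(b−1)`);
  `typeTwo_exclX6` (`2 ≤ m < b`, `c = 2m − 1`, `b + m` odd, `v z = v ϖ^m`: `2n₁ = b + m − 1`, `2n₂ = 2m − 2`, terms `exp(m−1) ≠ exp(m−2)`); `typeTwo_exclX7` (`1 ≤ m < b`, `c = 2m`,
  `b + m` odd, `v z = v ϖ^m`: `2n₁ = b + m − 1`, `2n₂ = 2m`, terms `exp(m−1) ≠ exp m`).  The families X5, X8, X9 (EQUAL term valuations in `G₀₁`) and X1, X2, X10, X11 (dual-Gram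
  (II) obstructions) are second-order and NOT in this file.
HONEST LABEL.  Count-neutral (`--supports`); nothing printed is asserted; (MS) stays a PROVER TARGET; the verdict of record for (D-RAM) stays PRINT [LanglandsShelstad1989 Thm. p. 484 ∕
Rogawski1990 Prop. 4.9.1 (a)] ∕ XL; `HC_CM` is proved only modulo the 7 printed citations (2 remaining named inputs: hLiu418 = `stmt-HodgeConjecture-24832`, h413 =
`stmt-HodgeConjecture-24833`) until rung 0 closes.

## References
* [Jacobowitz1962] R. Jacobowitz, *Hermitian forms over local fields*, Amer. J. Math. 84 (1962), §4 (Gram matrices), §7–§8 (unimodular and `ϖ`-modular lattices).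
* [Serre1980Trees] J.-P. Serre, *Trees* (1980), Ch. II §1.1 (lattices `g·𝒪^N`, Hermite normal form).
-/

set_option autoImplicit false

noncomputable section

namespace Summit.HodgeConjecture.HodgeConjecture.Cruxes.H413.F0P3cDyRamDiagonalTypeTwoExclX3467

open Matrix
open Literature.NumberTheory.Automorphic Literature.NumberTheory.Automorphic.HermitianLattice
open Literature.NumberTheory.Automorphic.UnitaryLatticeTree
open Summit.HodgeConjecture.HodgeConjecture.Cruxes.H413.F0P3cDyRamDiagonalTorusDefs
open Summit.HodgeConjecture.HodgeConjecture.Cruxes.H413.F0P3cDyRamDiagonalStableLatticeHNF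
open Summit.HodgeConjecture.HodgeConjecture.Cruxes.H413.F0P3cDyRamDiagonalHNFDualFrameValuesTypeTwo
open scoped Valued WithZero Matrix MatrixGroups

variable {K : Type*} [Field K] [Valued K ℤᵐ⁰]

/-! ## §1  The engine: pinned exponents and the `G₀₁` alternative -/

/-- **ENGINE.**  For a normalised type-2-polarisable HNF lattice with `v z = v(ϖ^k)`, `|y| = 1`, `b ≥ 1`: integers `n₁, n₂` (`|D₁| = exp 2n₁`, `|D₂| = exp 2n₂`) satisfying ★ PART 5's
integer sandwich in slots 1 and 2, and the `G₀₁` alternative — the valuations `exp(2n₁ − b)` of `σx·D₁·ϖ^b` and `exp(2n₂ − k)` of `σy·D₂·z` either COINCIDE or are BOTH `≤ 1`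
(★ `gram_values_of_type` entry `(0,1)` + `Valuation.map_add_of_distinct_val`). [cite: Jacobowitz1962, §4, §7–§8] [cite: Serre1980Trees, II §1.1] -/
theorem gram01_exponents {σ : K →+* K} (hvσ : ∀ a, Valued.v (σ a) = Valued.v a)
    (hfix : ∀ t : K, σ t = t → t ≠ 0 → ∃ n : ℤ, Valued.v t = WithZero.exp (2 * n))
    {ϖ : K} (hϖ : Valued.v ϖ = WithZero.exp (-1 : ℤ)) (b c : ℕ) {x y z : K}
    (hx : Valued.v x ≤ 1) (hy : Valued.v y ≤ 1) (hz : Valued.v z ≤ 1)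
    (hn : IsNormalisedLattice (latt (Matrix.of ![![1, 0, 0], ![x, ϖ ^ b, 0], ![y, z, ϖ ^ c]])))
    (hpol : ∃ D : Fin 3 → K, (∀ i, σ (D i) = D i ∧ D i ≠ 0) ∧
      IsVertexLattice σ ϖ (Matrix.diagonal D) 2 (latt (Matrix.of ![![1, 0, 0], ![x, ϖ ^ b, 0], ![y, z, ϖ ^ c]])))
    {k : ℕ} (hzk : Valued.v z = Valued.v (ϖ ^ k)) (hy1 : Valued.v y = 1) (hb : 1 ≤ b) :
    ∃ n₁ n₂ : ℤ, ((b : ℤ) - 1 ≤ 2 * n₁ ∧ (b : ℤ) + c - k - 1 ≤ 2 * n₁ ∧ (2 * n₁ ≤ (b : ℤ) ∨ 2 * n₁ ≤ (b : ℤ) + c - k)) ∧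
      ((c : ℤ) - 1 ≤ 2 * n₂ ∧ 2 * n₂ ≤ (c : ℤ)) ∧
      (2 * n₁ - (b : ℤ) = 2 * n₂ - k ∨ (2 * n₁ - (b : ℤ) ≤ 0 ∧ 2 * n₂ - (k : ℤ) ≤ 0)) := by
  obtain ⟨D, hD, hM⟩ := hpol
  have hD0 : ∀ i, D i ≠ 0 := fun i => (hD i).2
  have hϖ0 : ϖ ≠ 0 := (Valuation.ne_zero_iff Valued.v).1 (by rw [hϖ]; exact WithZero.exp_ne_zero)
  -- `|ϖ^n| = exp(−n)`
  have hq : ∀ n : ℕ, Valued.v (ϖ ^ n) = WithZero.exp (-(n : ℤ)) := fun n => by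
    rw [map_pow, hϖ, ← WithZero.exp_nsmul, nsmul_eq_mul, mul_neg, mul_one]
  have hq1 : ∀ n : ℕ, Valued.v (ϖ ^ n) ≤ 1 := fun n => by
    rw [hq, ← WithZero.exp_zero, WithZero.exp_le_exp]; omega
  -- normalisation at `b ≥ 1`: `|x| = 1`
  have hN := (normalised_latt_hnf_iff hx hy hz (hq1 b) (hq1 c)).1 hn
  have hx1 : Valued.v x = 1 := hN.1.resolve_left fun h => by
    rw [hq, ← WithZero.exp_zero, WithZero.exp_inj] at h; omega
  -- parity of the `σ`-fixed `D₁`, `D₂`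
  obtain ⟨n₁, hn₁⟩ := hfix (D 1) (hD 1).1 (hD0 1)
  obtain ⟨n₂, hn₂⟩ := hfix (D 2) (hD 2).1 (hD0 2)
  -- ★ PART 5: sandwich and the Gram entry `(0,1)`
  obtain ⟨⟨h2l, h2u⟩, ⟨h1l, h1z, h1u⟩, -⟩ := dualFrame_sandwich hvσ hϖ hD0 b c hn hM
  have hG01 := (gram_values_of_type hvσ hϖ0 D b c x y z hM).2.1
  refine ⟨n₁, n₂, ⟨?_, ?_, ?_⟩, ⟨?_, ?_⟩, ?_⟩
  · rw [hϖ, hn₁, ← WithZero.exp_add, WithZero.exp_le_exp] at h1l; omega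
  · rw [hϖ, hn₁, hzk, hq, ← WithZero.exp_add, ← WithZero.exp_add, WithZero.exp_le_exp] at h1z; omega
  · rcases h1u with h | h
    · left; rw [hn₁, WithZero.exp_le_exp] at h; exact h
    · right; rw [hn₁, hzk, hq, ← WithZero.exp_add, WithZero.exp_le_exp] at h; omega
  · rw [hϖ, hn₂, ← WithZero.exp_add, WithZero.exp_le_exp] at h2l; omega
  · rw [hn₂, WithZero.exp_le_exp] at h2u; exact h2u
  · -- the two terms of `G₀₁`
    have hA : Valued.v (σ x * D 1 * ϖ ^ b) = WithZero.exp (2 * n₁ - b) := by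
      rw [map_mul, map_mul, hvσ, hx1, one_mul, hn₁, hq, ← WithZero.exp_add, ← sub_eq_add_neg]
    have hB : Valued.v (σ y * D 2 * z) = WithZero.exp (2 * n₂ - k) := by
      rw [map_mul, map_mul, hvσ, hy1, one_mul, hn₂, hzk, hq, ← WithZero.exp_add, ← sub_eq_add_neg]
    by_cases heq : 2 * n₁ - (b : ℤ) = 2 * n₂ - k
    · exact Or.inl heq
    · right
      have hne : Valued.v (σ x * D 1 * ϖ ^ b) ≠ Valued.v (σ y * D 2 * z) := by
        rw [hA, hB]; exact fun h => heq (WithZero.exp_injective h)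
      rw [Valuation.map_add_of_distinct_val _ hne, max_le_iff, hA, hB, ← WithZero.exp_zero, WithZero.exp_le_exp, WithZero.exp_le_exp] at hG01
      exact hG01

/-! ## §2  The four one-entry kills -/

/-- **X3 IS EMPTY**: no normalised type-2-polarisable HNF lattice has `1 ≤ b`, `c` odd, `2b < c`, `v z = v(ϖ^{c−b})`, `|y| = 1` (`G₀₁`'s terms have valuations `exp b ≠ exp(b−1)`,
so `exp b ≤ 1` — absurd). [cite: Jacobowitz1962, §4, §7–§8] -/
theorem typeTwo_exclX3 {σ : K →+* K} (hvσ : ∀ a, Valued.v (σ a) = Valued.v a)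
    (hfix : ∀ t : K, σ t = t → t ≠ 0 → ∃ n : ℤ, Valued.v t = WithZero.exp (2 * n))
    {ϖ : K} (hϖ : Valued.v ϖ = WithZero.exp (-1 : ℤ)) (b c : ℕ) {x y z : K}
    (hx : Valued.v x ≤ 1) (hy : Valued.v y ≤ 1) (hz : Valued.v z ≤ 1)
    (hn : IsNormalisedLattice (latt (Matrix.of ![![1, 0, 0], ![x, ϖ ^ b, 0], ![y, z, ϖ ^ c]])))
    (hpol : ∃ D : Fin 3 → K, (∀ i, σ (D i) = D i ∧ D i ≠ 0) ∧
      IsVertexLattice σ ϖ (Matrix.diagonal D) 2 (latt (Matrix.of ![![1, 0, 0], ![x, ϖ ^ b, 0], ![y, z, ϖ ^ c]])))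
    (hX : 1 ≤ b ∧ c % 2 = 1 ∧ 2 * b < c ∧ Valued.v z = Valued.v (ϖ ^ (c - b)) ∧ Valued.v y = 1) : False := by
  obtain ⟨hb, hc2, hbc, hzk, hy1⟩ := hX
  obtain ⟨n₁, n₂, ⟨h1l, h1z, h1u⟩, ⟨h2l, h2u⟩, hG⟩ := gram01_exponents hvσ hfix hϖ b c hx hy hz hn hpol hzk hy1 hb
  have hk : ((c - b : ℕ) : ℤ) = (c : ℤ) - b := by omega
  rw [hk] at h1z h1u hG
  omega

/-- **X4 IS EMPTY**: no normalised type-2-polarisable HNF lattice has `2 ≤ b`, `c` even, `2b ≤ c`, `v z = v(ϖ^{c−b+1})`, `|y| = 1` (`G₀₁`'s terms: `exp(b−2) ≠ exp(b−1)`, so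
`exp(b−1) ≤ 1` — absurd for `b ≥ 2`). [cite: Jacobowitz1962, §4, §7–§8] -/
theorem typeTwo_exclX4 {σ : K →+* K} (hvσ : ∀ a, Valued.v (σ a) = Valued.v a)
    (hfix : ∀ t : K, σ t = t → t ≠ 0 → ∃ n : ℤ, Valued.v t = WithZero.exp (2 * n))
    {ϖ : K} (hϖ : Valued.v ϖ = WithZero.exp (-1 : ℤ)) (b c : ℕ) {x y z : K}
    (hx : Valued.v x ≤ 1) (hy : Valued.v y ≤ 1) (hz : Valued.v z ≤ 1)
    (hn : IsNormalisedLattice (latt (Matrix.of ![![1, 0, 0], ![x, ϖ ^ b, 0], ![y, z, ϖ ^ c]])))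
    (hpol : ∃ D : Fin 3 → K, (∀ i, σ (D i) = D i ∧ D i ≠ 0) ∧
      IsVertexLattice σ ϖ (Matrix.diagonal D) 2 (latt (Matrix.of ![![1, 0, 0], ![x, ϖ ^ b, 0], ![y, z, ϖ ^ c]])))
    (hX : 2 ≤ b ∧ c % 2 = 0 ∧ 2 * b ≤ c ∧ Valued.v z = Valued.v (ϖ ^ (c - b + 1)) ∧ Valued.v y = 1) : False := by
  obtain ⟨hb, hc2, hbc, hzk, hy1⟩ := hX
  obtain ⟨n₁, n₂, ⟨h1l, h1z, h1u⟩, ⟨h2l, h2u⟩, hG⟩ := gram01_exponents hvσ hfix hϖ b c hx hy hz hn hpol hzk hy1 (by omega)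
  have hk : ((c - b + 1 : ℕ) : ℤ) = (c : ℤ) - b + 1 := by omega
  rw [hk] at h1z h1u hG
  omega

/-- **X6 IS EMPTY**: no normalised type-2-polarisable HNF lattice has `2 ≤ m < b`, `c = 2m − 1`, `b + m` odd, `v z = v(ϖ^m)`, `|y| = 1` (`G₀₁`'s terms: `exp(m−1) ≠ exp(m−2)`,
so `exp(m−1) ≤ 1` — absurd for `m ≥ 2`). [cite: Jacobowitz1962, §4, §7–§8] -/
theorem typeTwo_exclX6 {σ : K →+* K} (hvσ : ∀ a, Valued.v (σ a) = Valued.v a)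
    (hfix : ∀ t : K, σ t = t → t ≠ 0 → ∃ n : ℤ, Valued.v t = WithZero.exp (2 * n))
    {ϖ : K} (hϖ : Valued.v ϖ = WithZero.exp (-1 : ℤ)) (b c : ℕ) {x y z : K}
    (hx : Valued.v x ≤ 1) (hy : Valued.v y ≤ 1) (hz : Valued.v z ≤ 1)
    (hn : IsNormalisedLattice (latt (Matrix.of ![![1, 0, 0], ![x, ϖ ^ b, 0], ![y, z, ϖ ^ c]])))
    (hpol : ∃ D : Fin 3 → K, (∀ i, σ (D i) = D i ∧ D i ≠ 0) ∧
      IsVertexLattice σ ϖ (Matrix.diagonal D) 2 (latt (Matrix.of ![![1, 0, 0], ![x, ϖ ^ b, 0], ![y, z, ϖ ^ c]])))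
    (hX : ∃ m : ℕ, 2 ≤ m ∧ m < b ∧ c = 2 * m - 1 ∧ (b + m) % 2 = 1 ∧ Valued.v z = Valued.v (ϖ ^ m) ∧ Valued.v y = 1) : False := by
  obtain ⟨m, hm2, hmb, hc, hbm, hzk, hy1⟩ := hX
  obtain ⟨n₁, n₂, ⟨h1l, h1z, h1u⟩, ⟨h2l, h2u⟩, hG⟩ := gram01_exponents hvσ hfix hϖ b c hx hy hz hn hpol hzk hy1 (by omega)
  omega

/-- **X7 IS EMPTY**: no normalised type-2-polarisable HNF lattice has `1 ≤ m < b`, `c = 2m`, `b + m` odd, `v z = v(ϖ^m)`, `|y| = 1` (`G₀₁`'s terms: `exp(m−1) ≠ exp m`, so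
`exp m ≤ 1` — absurd for `m ≥ 1`). [cite: Jacobowitz1962, §4, §7–§8] -/
theorem typeTwo_exclX7 {σ : K →+* K} (hvσ : ∀ a, Valued.v (σ a) = Valued.v a)
    (hfix : ∀ t : K, σ t = t → t ≠ 0 → ∃ n : ℤ, Valued.v t = WithZero.exp (2 * n))
    {ϖ : K} (hϖ : Valued.v ϖ = WithZero.exp (-1 : ℤ)) (b c : ℕ) {x y z : K}
    (hx : Valued.v x ≤ 1) (hy : Valued.v y ≤ 1) (hz : Valued.v z ≤ 1)
    (hn : IsNormalisedLattice (latt (Matrix.of ![![1, 0, 0], ![x, ϖ ^ b, 0], ![y, z, ϖ ^ c]])))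
    (hpol : ∃ D : Fin 3 → K, (∀ i, σ (D i) = D i ∧ D i ≠ 0) ∧
      IsVertexLattice σ ϖ (Matrix.diagonal D) 2 (latt (Matrix.of ![![1, 0, 0], ![x, ϖ ^ b, 0], ![y, z, ϖ ^ c]])))
    (hX : ∃ m : ℕ, 1 ≤ m ∧ m < b ∧ c = 2 * m ∧ (b + m) % 2 = 1 ∧ Valued.v z = Valued.v (ϖ ^ m) ∧ Valued.v y = 1) : False := by
  obtain ⟨m, hm1, hmb, hc, hbm, hzk, hy1⟩ := hX
  obtain ⟨n₁, n₂, ⟨h1l, h1z, h1u⟩, ⟨h2l, h2u⟩, hG⟩ := gram01_exponents hvσ hfix hϖ b c hx hy hz hn hpol hzk hy1 (by omega)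
  omega

end Summit.HodgeConjecture.HodgeConjecture.Cruxes.H413.F0P3cDyRamDiagonalTypeTwoExclX3467

end
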